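import Summits.ABC.ABC.Theorems.TwistAmplificationSharpModerateLawUnitPlaneDefs
import Literature.NumberTheory.CubicFields.MaximalCubicRings
import Mathlib.NumberTheory.NumberField.ClassNumber

/-!
# Crux `TwistAmplification.SharpModerateLaw` (stmt-ABC-1975), line `unit-plane-conic-two-torsion`:
the maximal order `R(F)` for the lever `stub_planarityFactorisation`

First helper file of the stub `stub_planarityFactorisation : PlanarityFactorisation` (objects of
`…SharpModerateLawUnitPlaneDefs.lean` §4: `planeElt F u v = a·u + v·ω ∈ R(F)`, `twoTorsionCard F = |Cl(R(F))[2]|`).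
For an irreducible MAXIMAL binary cubic form `F` the Delone–Faddeev ring `O = R(F)` (basis `1, ω, θ`) is the
maximal order of the cubic field `K_F` (`RingOfForm.toRingOfIntegers_surjective`), hence the integral closure
of `ℤ` in `K_F`: a Dedekind domain with finite class group (Mathlib's `IsIntegralClosure.isDedekindDomain`,
`ClassGroup.fintypeOfAdmissibleOfFinite`).  This file records those instances, keyed on
`[Fact F.IsIrreducible] [Fact (RingOfForm.IsMaximal F)]`, and proves

* `norm_planeElt` — **the norm form on the plane `ℤ ⊕ ℤω` is the index form**: `N(a·u + v·ω) = a²·F(u, v)`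
  (determinant of the multiplication matrix `leftMulMatrix_eq`; registered sub-goal of stmt-ABC-1975);
* `liftHom` — the universal property of `R(F)`: a pair `(w, t)` in a commutative ring satisfying the
  multiplication table `wt = −ad`, `w² = −ac + bw − at`, `t² = −bd + dw − ct` gives `R(F) → A`;
* `one_le_twoTorsionCard` — `|Cl(R(F))[2]| ≥ 1` (registered sub-goal; finiteness of the class group).
-/

noncomputable section

-- the mandated summit namespace `Summit.ABC.ABC` (summit = problem) trips the duplicate-namespace linter
set_option linter.dupNamespace false

namespace Summit.ABC.ABC.Theorems.SharpModerateLaw.UnitPlane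

open Literature.NumberTheory.CubicFields
open RingOfForm (omega theta RatAlgebra)


/-! ## 1. The norm of the plane element; the universal property of `R(F)` -/

/-- **The norm form on `ℤ ⊕ ℤω` is the index form**: `N(a u + v ω) = a² F(u, v)` (registered sub-goal
`norm_planeElt` of stmt-ABC-1975). -/
theorem norm_planeElt : ∀ (F : BinaryCubic ℤ) (u v : ℤ), Algebra.norm ℤ (planeElt F u v) = F.a ^ 2 * F.eval u v := by
  intro F u v
  rw [Algebra.norm_eq_matrix_det (RingOfForm.basis F), RingOfForm.leftMulMatrix_eq, Matrix.det_fin_three]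
  simp [planeElt, BinaryCubic.eval]
  ring

/-- The universal property of `R(F)`: elements `w, t` of a commutative ring `A` satisfying the
multiplication table give the ring map `x + yω + zθ ↦ x + y w + z t`. -/
def liftHom (F : BinaryCubic ℤ) {A : Type*} [CommRing A] (w t : A) (hwt : w * t = -((F.a : A) * F.d))
    (hww : w * w = -((F.a : A) * F.c) + (F.b : A) * w - (F.a : A) * t)
    (htt : t * t = -((F.b : A) * F.d) + (F.d : A) * w - (F.c : A) * t) : RingOfForm F →+* A where
  toFun P := (P.x : A) + (P.y : A) * w + (P.z : A) * t
  map_one' := by simp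
  map_mul' P Q := by
    simp only [RingOfForm.mul_x, RingOfForm.mul_y, RingOfForm.mul_z]
    push_cast
    linear_combination (-((P.y : A) * Q.y)) * hww + (-((P.z : A) * Q.z)) * htt
      + (-((P.y : A) * Q.z + (P.z : A) * Q.y)) * hwt
  map_zero' := by simp
  map_add' P Q := by
    simp only [RingOfForm.add_x, RingOfForm.add_y, RingOfForm.add_z]
    push_cast
    ring

/-- `liftHom` on `ω`. -/
@[simp] theorem liftHom_omega (F : BinaryCubic ℤ) {A : Type*} [CommRing A] (w t : A) (hwt hww htt) :
    liftHom F w t hwt hww htt (omega F) = w := by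
  simp [liftHom, RingOfForm.omega]

/-! ## 2. The maximal order `R(F)` of an irreducible maximal form: instances -/

section Ring

variable {F : BinaryCubic ℤ}

/-- `R(F)` has characteristic zero. -/
instance charZero_ringOfForm : CharZero (RingOfForm F) :=
  ⟨fun m n h => by simpa using congrArg RingOfForm.x h⟩

variable [hF : Fact F.IsIrreducible]

/-- `R(F)` is a domain for irreducible `F` (instance form of `isDomain_of_isIrreducible`). -/
instance isDomain_ringOfForm : IsDomain (RingOfForm F) := RingOfForm.isDomain_of_isIrreducible hF.out

/-- For maximal irreducible `F`, `R(F)` is the integral closure of `ℤ` in `K_F` (every integer of `K_F`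
lies in the image of `R(F)`: `toRingOfIntegers_surjective`). -/
theorem isIntegralClosure_of_isMaximal (hmax : RingOfForm.IsMaximal F) :
    IsIntegralClosure (RingOfForm F) ℤ (RatAlgebra F) := by
  refine ⟨RingOfForm.toAdjoinRoot_injective hF.out.1, fun {x} => ⟨fun hx => ?_, ?_⟩⟩
  · obtain ⟨o, ho⟩ :=
      (IsIntegralClosure.isIntegral_iff (A := NumberField.RingOfIntegers (RatAlgebra F))).mp hx
    obtain ⟨y, hy⟩ := RingOfForm.toRingOfIntegers_surjective hmax o
    refine ⟨y, ?_⟩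
    rw [RingOfForm.algebraMap_ratAlgebra_eq, ← RingOfForm.algebraMap_toRingOfIntegers, hy, ho]
  · rintro ⟨y, rfl⟩
    exact (Algebra.IsIntegral.isIntegral (R := ℤ) y).map (IsScalarTower.toAlgHom ℤ (RingOfForm F) _)

variable [hM : Fact (RingOfForm.IsMaximal F)]

/-- `R(F)` is the integral closure of `ℤ` in `K_F` (maximal irreducible `F`). -/
instance isIntegralClosure_ringOfForm : IsIntegralClosure (RingOfForm F) ℤ (RatAlgebra F) :=
  isIntegralClosure_of_isMaximal hM.out

/-- **`R(F)` is a Dedekind domain** for maximal irreducible `F`. -/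
instance isDedekindDomain_ringOfForm : IsDedekindDomain (RingOfForm F) :=
  IsIntegralClosure.isDedekindDomain ℤ ℚ (RatAlgebra F) (RingOfForm F)

/-- **The class group of `R(F)` is finite** for maximal irreducible `F` (Minkowski; Mathlib's
`ClassGroup.fintypeOfAdmissibleOfFinite`). -/
instance fintypeClassGroup_ringOfForm : Fintype (ClassGroup (RingOfForm F)) :=
  ClassGroup.fintypeOfAdmissibleOfFinite ℚ (RatAlgebra F) AbsoluteValue.absIsAdmissible

end Ring

/-- **`|Cl(R(F))[2]| ≥ 1`** for irreducible maximal `F` (registered sub-goal `one_le_twoTorsionCard` of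
stmt-ABC-1975): the class group is finite and the trivial class is `2`-torsion. -/
theorem one_le_twoTorsionCard : ∀ F : BinaryCubic ℤ, F.IsIrreducible → RingOfForm.IsMaximal F → 1 ≤ twoTorsionCard F := by
  intro F hirr hmax
  haveI : Fact F.IsIrreducible := ⟨hirr⟩
  haveI : Fact (RingOfForm.IsMaximal F) := ⟨hmax⟩
  unfold twoTorsionCard
  rw [dif_pos hirr]
  haveI : Nonempty {c : ClassGroup (RingOfForm F) // c ^ 2 = 1} := ⟨⟨1, one_pow 2⟩⟩
  exact Nat.card_pos

end Summit.ABC.ABC.Theorems.SharpModerateLaw.UnitPlane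

end
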